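import Literature.NumberTheory.Automorphic.CuspidalCohomologyGL
import HarnessLib

/-!
# Hecke operators preserve the interior cohomology `H^q_!`

Topic `NumberTheory/Automorphic`; companion of `CuspidalCohomologyGL` (definition request
`defn-CuspidalCohomologyGL`; named facts `cuspidalEigenclass_exists`,
`interiorEigenclass_isCuspidal`).  There the interior cohomology
`H^q_!(S_L, Ṽ) = ker (H^q(S_L, Ṽ) → H^q(∂S_L, Ṽ))` of an arithmetic quotient is modelled by an
explicit double complex `C^j(Γ, Fun(N(P)_p × 𝒢/L, V))` over the nerve of the poset `P` of proper
rational parabolics (`TwistedQuotient.IsBdryTrivialization`, `TwistedQuotient.interiorCohomology`),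
and the Hecke operators `T_g = [L g L]` are defined on all of `H^q` (`TwistedQuotient.heckeOperator`);
their restriction to `H^q_!` was left open ("they preserve it, being induced by proper
correspondences", design notes of that file).  This file supplies it: the double-coset operator acts
on the coset variable of the boundary cochains as well (`bdryHeckeFun`,
`(T_g F)(x, cL) = ∑_{hL ⊆ LgL} F(x, chL)`), commuting with the `Γ`-action
(`bdryHeckeFun_bdryRepresentation`, reduced to `ArithmeticQuotient.heckeFun_coeffRepresentation`),
with the coface maps of the nerve (`bdryDHom_comp_bdryHeckeRepHom`) and with the coaugmentation
(`coaugHom_comp_bdryHeckeRepHom`); hence it maps zig-zags to zig-zags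
(`IsBdryTrivialization.hecke`) and **`T_g H^q_! ⊆ H^q_!`** (`heckeEnd_mem_interiorCohomology`; for
`GL_n/ℚ`, `GLnCohomology.heckeOp_mem_interiorLevelCohomology` and
`heckeOp_mem_cuspidalCohomologyGL`).  This is the statement that the Hecke correspondences extend to
the Borel–Serre compactification compatibly with the boundary, [cite: Schwermer2010, §5.3]
(`H^•_!` "is a module under the Hecke algebra"); here it is a formal consequence of the model.

## Main results

* `TwistedQuotient.bdryHeckeFun`, `TwistedQuotient.bdryHeckeRepHom` — `[L g L]` on
  `Fun(N(P)_p × 𝒢/L, V)` as a morphism of `Γ`-representations.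
* `TwistedQuotient.coaugHom_comp_bdryHeckeRepHom`, `TwistedQuotient.bdryDHom_comp_bdryHeckeRepHom` —
  compatibility with restriction to the boundary and with the coface maps.
* `TwistedQuotient.IsBdryTrivialization.hecke` — the image of a zig-zag under `T_g` is a zig-zag
  for `T_g z`.
* `TwistedQuotient.heckeEnd_mem_interiorCohomology` — `x ∈ H^q_! ⟹ T_g x ∈ H^q_!`.
* `TwistedQuotient.heckeEndInterior` — `T_g` restricted to `H^q_!` (`LinearMap.restrict`).
* `GLnCohomology.heckeOp_mem_interiorLevelCohomology`, `heckeOp_mem_cuspidalCohomologyGL`,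
  `heckeT_mem_cuspidalCohomologyGL` — the case `GL_n/ℚ`:
  `T_g (CuspidalCohomologyGL n N λ) ⊆ CuspidalCohomologyGL n N λ`; `CuspidalCohomologyGL.heckeOp`,
  `CuspidalCohomologyGL.heckeT` — the operators `T_g`, `T_{v,i}` on `CuspidalCohomologyGL n N λ`
  itself (the Hecke-module structure on `H^{b_n}_!`).

## References

* J. Schwermer, *Geometric cycles, arithmetic groups and their cohomology*, Bull. AMS 47 (2010),
  §5.3 [Schwermer2010].
* G. Shimura, *Introduction to the arithmetic theory of automorphic functions* (1971), Ch. 3, §8.3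
  (double-coset operators) [ShimuraIATAF1971].
-/

noncomputable section

open CategoryTheory
open scoped Classical

universe u

namespace Literature.NumberTheory.Automorphic

namespace TwistedQuotient

open groupCohomology

variable {k : Type u} [CommRing k] {Γ 𝒢 : Type u} [Group Γ] [Group 𝒢]
variable (ι : Γ →* 𝒢) (L : Subgroup 𝒢) {V : Type u} [AddCommGroup V] [Module k V]
  (ρ : Representation k Γ V) (P : Type u) [Preorder P] [MulAction Γ P]
  (hP : ∀ γ : Γ, Monotone fun x : P => γ • x) (g : 𝒢)

/-! ### The double-coset operator on boundary cochains -/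

variable (k) in
/-- The Hecke operator `[L g L]` on `V`-valued cochains of `N(P) × 𝒢/L`, acting on the coset
variable: `(T_g F)(x, cL) = ∑_{hL ⊆ LgL} F(x, chL)` (`ArithmeticQuotient.heckeFun` applied to
`F(x, ·)`). [cite: ShimuraIATAF1971, Ch. 3, §8.3] -/
def bdryHeckeFun (p : ℕ) : (BdrySimplex L P p → V) →ₗ[k] (BdrySimplex L P p → V) where
  toFun F s := ArithmeticQuotient.heckeFun k L g V (fun c => F (s.1, c)) s.2
  map_add' F G := by
    funext s
    change ArithmeticQuotient.heckeFun k L g V ((fun c => F (s.1, c)) + fun c => G (s.1, c)) s.2 = _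
    rw [map_add]
    rfl
  map_smul' r F := by
    funext s
    change ArithmeticQuotient.heckeFun k L g V (r • fun c => F (s.1, c)) s.2 = _
    rw [map_smul]
    rfl

/-- Unfolding lemma for `bdryHeckeFun`. [folklore] -/
theorem bdryHeckeFun_apply (p : ℕ) (F : BdrySimplex L P p → V) (s : BdrySimplex L P p) :
    bdryHeckeFun k L P g p F s = ArithmeticQuotient.heckeFun k L g V (fun c => F (s.1, c)) s.2 :=
  rfl

/-- The boundary Hecke operator commutes with the `Γ`-action (left and right translations commute:
`ArithmeticQuotient.heckeFun_coeffRepresentation` in the coset variable). [folklore] -/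
theorem bdryHeckeFun_bdryRepresentation (p : ℕ) (γ : Γ) (F : BdrySimplex L P p → V) :
    bdryHeckeFun k L P g p (bdryRepresentation ι L ρ P hP p γ F) =
      bdryRepresentation ι L ρ P hP p γ (bdryHeckeFun k L P g p F) := by
  funext s
  have key := congr_fun (heckeFun_coeffRepresentation ι L ρ g γ
    (fun c => F ((bdryAct ι L hP p γ⁻¹ s).1, c))) s.2
  rw [bdryHeckeFun_apply, bdryRepresentation_apply, bdryHeckeFun_apply]
  have h1 : (fun c => bdryRepresentation ι L ρ P hP p γ F (s.1, c)) =
      coeffRepresentation ι L ρ γ (fun c => F ((bdryAct ι L hP p γ⁻¹ s).1, c)) := by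
    funext c
    rw [bdryRepresentation_apply, coeffRepresentation_apply]
    congr 2
    exact Prod.ext rfl (by rw [bdryAct_snd, map_inv])
  have h2 : (bdryAct ι L hP p γ⁻¹ s).2 = (ι γ)⁻¹ • s.2 := by
    rw [bdryAct_snd, map_inv]
  rw [h1, key, coeffRepresentation_apply, h2]

/-- `[L g L]` on `Fun(N(P)_p × 𝒢/L, V)` as an endomorphism in `Rep k Γ`. [folklore] -/
def bdryHeckeRepHom (p : ℕ) : bdryRep ι L ρ P hP p ⟶ bdryRep ι L ρ P hP p :=
  Rep.ofHom ⟨bdryHeckeFun k L P g p, fun γ =>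
    LinearMap.ext fun F => bdryHeckeFun_bdryRepresentation ι L ρ P hP g p γ F⟩

/-- Unfolding lemma for `bdryHeckeRepHom`. [folklore] -/
@[simp]
theorem bdryHeckeRepHom_hom_apply (p : ℕ) (F : BdrySimplex L P p → V) :
    (bdryHeckeRepHom ι L ρ P hP g p).hom F = bdryHeckeFun k L P g p F :=
  rfl

/-- **Hecke operators commute with restriction to the boundary**:
`coaug ∘ T_g = T_g ∘ coaug` (`(T_g f)(c) = ∑ f(chL)` on both sides). [folklore] -/
theorem coaugHom_comp_bdryHeckeRepHom :
    coaugHom ι L ρ P hP ≫ bdryHeckeRepHom ι L ρ P hP g 0 = heckeRepHom ι L ρ g ≫ coaugHom ι L ρ P hP :=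
  Rep.hom_ext (Representation.IntertwiningMap.ext (LinearMap.ext fun _ => funext fun _ => rfl))

/-- **Hecke operators commute with the coface maps of the nerve**: the faces only move the chain
variable, `T_g` only the coset variable. [folklore] -/
theorem bdryDHom_comp_bdryHeckeRepHom (p : ℕ) :
    bdryDHom ι L ρ P hP p ≫ bdryHeckeRepHom ι L ρ P hP g (p + 1) =
      bdryHeckeRepHom ι L ρ P hP g p ≫ bdryDHom ι L ρ P hP p := by
  refine Rep.hom_ext (Representation.IntertwiningMap.ext (LinearMap.ext fun F => funext fun s => ?_))
  change bdryHeckeFun k L P g (p + 1) (bdryD k L P p F) s = bdryD k L P p (bdryHeckeFun k L P g p F) s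
  rw [bdryHeckeFun_apply, bdryD_apply]
  simp only [bdryD_apply, ArithmeticQuotient.heckeFun_apply, bdryHeckeFun_apply]
  split_ifs with h
  · rw [Finset.sum_comm]
    refine Finset.sum_congr rfl fun j _ => ?_
    rw [Finset.smul_sum]
    rfl
  · simp

/-! ### Zig-zags are preserved; `T_g H^q_! ⊆ H^q_!` -/

/-- **The Hecke image of a zig-zag is a zig-zag**: if `h` witnesses that the restriction of the
cocycle `z` to the boundary is a coboundary of the total complex, then `T_g h` does so for `T_g z`
(`T_g` is a map of double complexes compatible with the coaugmentation). [cite: Schwermer2010, §5.3] -/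
theorem IsBdryTrivialization.hecke (q : ℕ) {z : cocycles (coeffRep ι L ρ) q}
    {h : (p j : ℕ) → (inhomogeneousCochains (bdryRep ι L ρ P hP p)).X j}
    (t : IsBdryTrivialization ι L ρ P hP q z h) :
    IsBdryTrivialization ι L ρ P hP q
      (cocyclesMap (A := coeffRep ι L ρ) (B := coeffRep ι L ρ) (MonoidHom.id Γ) (heckeRepHom ι L ρ g) q z)
      (fun p j => ((cochainsMap (A := bdryRep ι L ρ P hP p) (B := bdryRep ι L ρ P hP p) (MonoidHom.id Γ) (bdryHeckeRepHom ι L ρ P hP g p)).f j).hom (h p j)) := by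
  -- notation: the Hecke chain maps
  have hchain : ∀ (p i j : ℕ) (x : (inhomogeneousCochains (bdryRep ι L ρ P hP p)).X i),
      ((inhomogeneousCochains (bdryRep ι L ρ P hP p)).d i j).hom
          (((cochainsMap (A := bdryRep ι L ρ P hP p) (B := bdryRep ι L ρ P hP p) (MonoidHom.id Γ) (bdryHeckeRepHom ι L ρ P hP g p)).f i).hom x) =
        ((cochainsMap (A := bdryRep ι L ρ P hP p) (B := bdryRep ι L ρ P hP p) (MonoidHom.id Γ) (bdryHeckeRepHom ι L ρ P hP g p)).f j).hom
          (((inhomogeneousCochains (bdryRep ι L ρ P hP p)).d i j).hom x) := by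
    intro p i j x
    have hc := (cochainsMap (A := bdryRep ι L ρ P hP p) (B := bdryRep ι L ρ P hP p) (MonoidHom.id Γ) (bdryHeckeRepHom ι L ρ P hP g p)).comm i j
    exact (ModuleCat.hom_ext_iff.mp hc |> fun e => LinearMap.congr_fun e x)
  -- compatibility with the coface maps on cochains
  have hD : ∀ (p j : ℕ) (x : (inhomogeneousCochains (bdryRep ι L ρ P hP p)).X j),
      ((bdryDCochains ι L ρ P hP p).f j).hom
          (((cochainsMap (A := bdryRep ι L ρ P hP p) (B := bdryRep ι L ρ P hP p) (MonoidHom.id Γ) (bdryHeckeRepHom ι L ρ P hP g p)).f j).hom x) =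
        ((cochainsMap (A := bdryRep ι L ρ P hP (p + 1)) (B := bdryRep ι L ρ P hP (p + 1)) (MonoidHom.id Γ) (bdryHeckeRepHom ι L ρ P hP g (p + 1))).f j).hom
          (((bdryDCochains ι L ρ P hP p).f j).hom x) := by
    intro p j x
    change ((cochainsMap (A := bdryRep ι L ρ P hP p) (B := bdryRep ι L ρ P hP p) (MonoidHom.id Γ) (bdryHeckeRepHom ι L ρ P hP g p) ≫
        cochainsMap (A := bdryRep ι L ρ P hP p) (B := bdryRep ι L ρ P hP (p + 1)) (MonoidHom.id Γ) (bdryDHom ι L ρ P hP p)).f j).hom x =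
      ((cochainsMap (A := bdryRep ι L ρ P hP p) (B := bdryRep ι L ρ P hP (p + 1)) (MonoidHom.id Γ) (bdryDHom ι L ρ P hP p) ≫
        cochainsMap (A := bdryRep ι L ρ P hP (p + 1)) (B := bdryRep ι L ρ P hP (p + 1)) (MonoidHom.id Γ) (bdryHeckeRepHom ι L ρ P hP g (p + 1))).f j).hom x
    rw [← cochainsMap_id_comp, ← cochainsMap_id_comp, bdryDHom_comp_bdryHeckeRepHom]
  -- compatibility with the coaugmentation on cochains
  have hC : ∀ (j : ℕ) (x : (inhomogeneousCochains (coeffRep ι L ρ)).X j),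
      ((coaugCochains ι L ρ P hP).f j).hom
          (((cochainsMap (A := coeffRep ι L ρ) (B := coeffRep ι L ρ) (MonoidHom.id Γ) (heckeRepHom ι L ρ g)).f j).hom x) =
        ((cochainsMap (A := bdryRep ι L ρ P hP 0) (B := bdryRep ι L ρ P hP 0) (MonoidHom.id Γ) (bdryHeckeRepHom ι L ρ P hP g 0)).f j).hom
          (((coaugCochains ι L ρ P hP).f j).hom x) := by
    intro j x
    change ((cochainsMap (A := coeffRep ι L ρ) (B := coeffRep ι L ρ) (MonoidHom.id Γ) (heckeRepHom ι L ρ g) ≫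
        cochainsMap (A := coeffRep ι L ρ) (B := bdryRep ι L ρ P hP 0) (MonoidHom.id Γ) (coaugHom ι L ρ P hP)).f j).hom x =
      ((cochainsMap (A := coeffRep ι L ρ) (B := bdryRep ι L ρ P hP 0) (MonoidHom.id Γ) (coaugHom ι L ρ P hP) ≫
        cochainsMap (A := bdryRep ι L ρ P hP 0) (B := bdryRep ι L ρ P hP 0) (MonoidHom.id Γ) (bdryHeckeRepHom ι L ρ P hP g 0)).f j).hom x
    rw [← cochainsMap_id_comp, ← cochainsMap_id_comp, coaugHom_comp_bdryHeckeRepHom]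
  -- the cocycle map on cochains
  have hZ : (iCocycles (coeffRep ι L ρ) q).hom (cocyclesMap (A := coeffRep ι L ρ) (B := coeffRep ι L ρ) (MonoidHom.id Γ) (heckeRepHom ι L ρ g) q z) =
      ((cochainsMap (A := coeffRep ι L ρ) (B := coeffRep ι L ρ) (MonoidHom.id Γ) (heckeRepHom ι L ρ g)).f q).hom ((iCocycles (coeffRep ι L ρ) q).hom z) := by
    have e := HomologicalComplex.cyclesMap_i (cochainsMap (A := coeffRep ι L ρ) (B := coeffRep ι L ρ) (MonoidHom.id Γ) (heckeRepHom ι L ρ g)) q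
    exact ModuleCat.hom_ext_iff.mp e |> fun e' => LinearMap.congr_fun e' z
  refine ⟨?_, ?_, ?_⟩
  · rw [hchain, t.start, hZ, hC]
  · intro p j hpj
    rw [hD, t.step p j hpj, hchain]
  · rw [hD, t.stop, map_zero]

/-- **Hecke operators preserve the interior cohomology**: `x ∈ H^q_!(S_L, Ṽ) ⟹ T_g x ∈ H^q_!`.
[cite: Schwermer2010, §5.3] -/
theorem heckeEnd_mem_interiorCohomology (q : ℕ) {x : cohomology ι L ρ q}
    (hx : x ∈ interiorCohomology ι L ρ P hP q) :
    heckeEnd ι L ρ g q x ∈ interiorCohomology ι L ρ P hP q := by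
  rw [mem_interiorCohomology_iff] at hx ⊢
  obtain ⟨z, rfl, h, t⟩ := hx
  refine ⟨cocyclesMap (A := coeffRep ι L ρ) (B := coeffRep ι L ρ) (MonoidHom.id Γ) (heckeRepHom ι L ρ g) q z,
    ?_, _, t.hecke ι L ρ P hP g q⟩
  exact (π_map_apply (A := coeffRep ι L ρ) (B := coeffRep ι L ρ) (MonoidHom.id Γ) (heckeRepHom ι L ρ g) q z).symm

/-- The interior cohomology is stable under every Hecke operator (submodule form). [cite: Schwermer2010, §5.3] -/
theorem interiorCohomology_le_comap_heckeEnd (q : ℕ) :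
    interiorCohomology ι L ρ P hP q ≤ (interiorCohomology ι L ρ P hP q).comap (heckeEnd ι L ρ g q) :=
  fun _ hx => heckeEnd_mem_interiorCohomology ι L ρ P hP g q hx

/-- **`T_g` on `H^q_!`**: the Hecke operator restricted to the interior cohomology (Mathlib
`LinearMap.restrict`). [cite: Schwermer2010, §5.3] -/
def heckeEndInterior (q : ℕ) : Module.End k (interiorCohomology ι L ρ P hP q) :=
  (heckeEnd ι L ρ g q).restrict fun _ hx => heckeEnd_mem_interiorCohomology ι L ρ P hP g q hx

/-- Unfolding lemma: `heckeEndInterior` is `heckeEnd` on representatives. [folklore] -/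
@[simp]
theorem coe_heckeEndInterior_apply (q : ℕ) (x : interiorCohomology ι L ρ P hP q) :
    ((heckeEndInterior ι L ρ P hP g q x : interiorCohomology ι L ρ P hP q) : cohomology ι L ρ q) =
      heckeEnd ι L ρ g q x :=
  rfl

end TwistedQuotient

/-! ### `GL_n / ℚ` -/

namespace GLnCohomology

variable (k : Type) [Field k] [CharZero k]

/-- **`T_g H^q_!(S(K_f(N)), Ṽ_λ) ⊆ H^q_!`** for every `g ∈ GL_n(𝔸_{ℚ,f})`. [cite: Schwermer2010, §5.3] -/
theorem heckeOp_mem_interiorLevelCohomology (n N : ℕ) (wt : Fin n → ℤ) (q : ℕ)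
    (g : BigHeckeGLn.FiniteAdelicGL n ℚ) {x : levelCohomology k n N wt q}
    (hx : x ∈ interiorLevelCohomology k n N wt q) :
    heckeOp k n N wt q g x ∈ interiorLevelCohomology k n N wt q :=
  TwistedQuotient.heckeEnd_mem_interiorCohomology (V := CoeffModule k n wt) (diagPos n) (level n N)
    (coeffRepPos k n wt) (ProperSubspace n) (smul_properSubspace_mono n) g q hx

/-- **The Hecke operators preserve `CuspidalCohomologyGL n N λ = H^{b_n}_!`.** [cite: Schwermer2010, §5.3] -/
theorem heckeOp_mem_cuspidalCohomologyGL (n N : ℕ) (wt : Fin n → ℤ)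
    (g : BigHeckeGLn.FiniteAdelicGL n ℚ) {x : levelCohomology ℂ n N wt (bottomDegree n)}
    (hx : x ∈ CuspidalCohomologyGL n N wt) :
    heckeOp ℂ n N wt (bottomDegree n) g x ∈ CuspidalCohomologyGL n N wt :=
  heckeOp_mem_interiorLevelCohomology ℂ n N wt (bottomDegree n) g hx

/-- In particular the unramified operators `T_{v,i}` preserve `CuspidalCohomologyGL n N λ`.
[cite: Schwermer2010, §5.3] -/
theorem heckeT_mem_cuspidalCohomologyGL (n N : ℕ) (wt : Fin n → ℤ)
    (v : IsDedekindDomain.HeightOneSpectrum (NumberField.RingOfIntegers ℚ)) (i : ℕ)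
    {x : levelCohomology ℂ n N wt (bottomDegree n)} (hx : x ∈ CuspidalCohomologyGL n N wt) :
    heckeT ℂ n N wt (bottomDegree n) v i x ∈ CuspidalCohomologyGL n N wt :=
  heckeOp_mem_cuspidalCohomologyGL n N wt _ hx

end GLnCohomology

open GLnCohomology in
/-- **`CuspidalCohomologyGL n N λ` as a Hecke module**: the operator `T_g`, `g ∈ GL_n(𝔸_{ℚ,f})`, on
`H^{b_n}_!(S(K_f(N)), Ṽ_λ ⊗ ℂ)`. [cite: Schwermer2010, §5.3] -/
def CuspidalCohomologyGL.heckeOp (n N : ℕ) (wt : Fin n → ℤ) (g : BigHeckeGLn.FiniteAdelicGL n ℚ) :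
    Module.End ℂ (CuspidalCohomologyGL n N wt) :=
  (GLnCohomology.heckeOp ℂ n N wt (bottomDegree n) g).restrict
    fun _ hx => heckeOp_mem_cuspidalCohomologyGL n N wt g hx

open GLnCohomology in
/-- Unfolding lemma for `CuspidalCohomologyGL.heckeOp`. [folklore] -/
@[simp]
theorem CuspidalCohomologyGL.coe_heckeOp_apply (n N : ℕ) (wt : Fin n → ℤ)
    (g : BigHeckeGLn.FiniteAdelicGL n ℚ) (x : CuspidalCohomologyGL n N wt) :
    ((CuspidalCohomologyGL.heckeOp n N wt g x : CuspidalCohomologyGL n N wt) :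
        levelCohomology ℂ n N wt (bottomDegree n)) =
      GLnCohomology.heckeOp ℂ n N wt (bottomDegree n) g x :=
  rfl

open GLnCohomology in
/-- The unramified operator `T_{v,i}` on `CuspidalCohomologyGL n N λ`. [cite: Schwermer2010, §5.3] -/
abbrev CuspidalCohomologyGL.heckeT (n N : ℕ) (wt : Fin n → ℤ)
    (v : IsDedekindDomain.HeightOneSpectrum (NumberField.RingOfIntegers ℚ)) (i : ℕ) :
    Module.End ℂ (CuspidalCohomologyGL n N wt) :=
  CuspidalCohomologyGL.heckeOp n N wt (BigHeckeGLn.heckeElement n ℚ v i)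

end Literature.NumberTheory.Automorphic
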